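import Literature.NumberTheory.Weil1964.ArchPlacePhaseHom
import Literature.NumberTheory.Weil1964.ArchWeilDatum
import Literature.Analysis.SegalBargmann.SchwartzCarrierTransport
import HarnessLib

/-!
# An archimedean Weil datum is invariant under relabelling of the coordinates (Weil 1964, n° 12; Folland 1989, (1.25))

Topic `NumberTheory/Weil1964`; namespace `Literature.NumberTheory.Weil1964`.  KERNEL MATHEMATICS ONLY: two explicit
definitions (a continuous linear equivalence and a unitary) and proved theorems; no `def … : Prop` record, no axiom, no
proof hole.

For an index bijection `E : σ ≃ σ′` the coordinate permutation `y ↦ y ∘ E : ℝ^{σ′} ≃ ℝ^σ` carries the tree's Schwartz-level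
Schrödinger formalism on `𝓢(ℝ^{σ′})` to the one on `𝓢(ℝ^σ)` (`SchwartzCarrierTransport`: `schwartzTransport`, `rhoSD`,
`opTransport`, `repTransport`, `l2Transport`), and the symplectic group along `reindexSp E : Sp(σ′) →* Sp(σ)`
(`ArchPlacePhaseHom` §1, acting by `reindexPhase E`).  This file records, for ARBITRARY `E`, what
`KonnoKonno2007/JunctionSwapSymmetry` §2–§5 proved for the particular relabelling `swapIdx` of a dual pair:

* §1 `reindexCLE E : (σ′ → ℝ) ≃L[ℝ] (σ → ℝ)`, `y ↦ y ∘ E`; it and its inverse preserve Lebesgue measure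
  (`measurePreserving_reindexCLE`, `measurePreserving_reindexCLE_symm`); the transported Heisenberg operators are the
  native ones at the relabelled point: **`rhoSD_reindexCLE : rhoSD (reindexCLE E) p q = ρ(p ∘ E⁻¹, q ∘ E⁻¹)`**;
* §2 the permutation unitary **`l2Reindex E : L²(ℝ^{σ′}) ≃ₗᵢ L²(ℝ^σ)`** (`g ↦ g ∘ E⁻¹-pullback`), `toL2_schwartzTransport_reindexCLE`,
  and transport of lifts `liftsTo_opTransport_reindex`;
* §3 **`IsArchWeilDatum.reindex : IsArchWeilDatum ι𝕎 ω → IsArchWeilDatum ((reindexSp E).comp ι𝕎) (repTransport (reindexCLE E) ω)`**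
  — (w1), (w2), (w2′) all transport (`IsArchWeilDatum.of_carrier`); with `IsArchWeilDatum.comp` this moves a datum along any
  relabelling of coordinates and any continuous homomorphism of groups.

Use (Hodge-CM model-construction cell): the (J-arch) datum of the CM theta pin is produced in weil-2's place frame
`Fin m × {v // v real}` (`HodgeCM/Model/HypCensus/ArchDatumPlacesCM`); its consumers (the archimedean factorisation
`IsArchWeilDatum.exists_circle_twist_factorisation_clm`, `Model/ArchKTypeJunction` § 2) are typed on a block frame `σ₁ ⊕ σ₂`;
this file and `ArchPlacePhaseHomBlock` are the relabelling between the two.  Everything is PROVED; nothing cited is a hypothesis.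

## References

* [Weil1964] A. Weil, *Sur certains groupes d'opérateurs unitaires*, Acta Math. 111 (1964), Chap. I n° 12 p. 160.
* [Folland1989] G. B. Folland, *Harmonic Analysis in Phase Space*, Princeton UP (1989), §1.3 (1.25), Prop. (1.43), §4.2 (4.23).

## Provenance

LEAN-IN-TREE rule (2026-08-18), pub-hodgecm model-construction sub-cell, discharge seat mc-discharge-3 (ticket D-3 follow-on (T1):
glue from the (J-arch) datum in the place frame to the block frame).  Nothing here is a claim of the manuscripts adjudicated by
that cell.
-/

set_option autoImplicit false

noncomputable section

open MeasureTheory Complex SchwartzMap Matrix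

namespace Literature.NumberTheory.Weil1964

open Literature.Analysis.SegalBargmann Literature.RepresentationTheory.HeisenbergGroup
open Literature.RepresentationTheory.KonnoKonno2007

/-! ## §1 The coordinate permutation as a change of carrier -/

section Carrier

variable {σ σ' : Type*} [Fintype σ] [Fintype σ']

/-- the coordinate permutation `y ↦ y ∘ E` as a continuous linear equivalence `ℝ^{σ′} ≃ ℝ^σ`. [folklore] -/
def reindexCLE (E : σ ≃ σ') : (σ' → ℝ) ≃L[ℝ] (σ → ℝ) :=
  (LinearEquiv.funCongrLeft ℝ ℝ E).toContinuousLinearEquiv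

omit [Fintype σ] in
/-- `reindexCLE E y = y ∘ E`. [folklore] -/
@[simp] theorem reindexCLE_apply (E : σ ≃ σ') (y : σ' → ℝ) (i : σ) : reindexCLE E y i = y (E i) := rfl

omit [Fintype σ] in
/-- `(reindexCLE E)⁻¹ x = x ∘ E⁻¹`. [folklore] -/
@[simp] theorem reindexCLE_symm_apply (E : σ ≃ σ') (x : σ → ℝ) (j : σ') :
    (reindexCLE E).symm x j = x (E.symm j) := rfl

omit [Fintype σ] in
/-- `(reindexCLE E)⁻¹ x = x ∘ E⁻¹` as functions. [folklore] -/
theorem reindexCLE_symm_eq (E : σ ≃ σ') (x : σ → ℝ) : (reindexCLE E).symm x = x ∘ E.symm := rfl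

omit [Fintype σ] in
/-- `reindexCLE E y = y ∘ E` as functions. [folklore] -/
theorem reindexCLE_eq (E : σ ≃ σ') (y : σ' → ℝ) : reindexCLE E y = y ∘ E := rfl

/-- the inverse permutation preserves Lebesgue measure. [folklore] -/
theorem measurePreserving_reindexCLE_symm (E : σ ≃ σ') :
    MeasurePreserving (reindexCLE E).symm (volume : Measure (σ → ℝ)) volume := by
  have h := volume_measurePreserving_piCongrLeft (fun _ : σ' => ℝ) E
  convert h using 1
  funext x
  funext j
  rw [MeasurableEquiv.coe_piCongrLeft, Equiv.piCongrLeft_apply_eq_cast]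
  simp

/-- the permutation preserves Lebesgue measure. [folklore] -/
theorem measurePreserving_reindexCLE (E : σ ≃ σ') :
    MeasurePreserving (reindexCLE E) (volume : Measure (σ' → ℝ)) volume := by
  have h := volume_measurePreserving_piCongrLeft (fun _ : σ => ℝ) E.symm
  convert h using 1
  funext y
  funext i
  rw [MeasurableEquiv.coe_piCongrLeft, Equiv.piCongrLeft_apply_eq_cast]
  simp

/-- **The transported Heisenberg operators are the native ones at the relabelled point**:
`rhoSD (reindexCLE E) p q = ρ(p ∘ E⁻¹, q ∘ E⁻¹)`. [cite: Folland1989, §1.3 (1.25)] -/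
theorem rhoSD_reindexCLE (E : σ ≃ σ') (p q : σ → ℝ) (f : SchwartzMap (σ' → ℝ) ℂ) :
    rhoSD (reindexCLE E) p q f = rhoS (p ∘ E.symm) (q ∘ E.symm) f := by
  ext y
  rw [rhoSD_apply, rhoS_apply, reindexCLE_symm_eq]
  congr 1
  have h1 : ∑ i, q i * reindexCLE E y i = ∑ j, (q ∘ E.symm) j * y j := by
    rw [← Equiv.sum_comp E]
    simp only [reindexCLE_apply, Function.comp_apply, Equiv.symm_apply_apply]
  have h2 : ∑ i, p i * q i = ∑ j, (p ∘ E.symm) j * (q ∘ E.symm) j := by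
    rw [← Equiv.sum_comp E]
    simp only [Function.comp_apply, Equiv.symm_apply_apply]
  simp only [rhoMul, h1, h2]

/-- `schwartzTransport (reindexCLE E)` intertwines the Heisenberg operators at relabelled points. [folklore] -/
theorem schwartzTransport_reindexCLE_rhoS (E : σ ≃ σ') (p q : σ → ℝ) (f : SchwartzMap (σ' → ℝ) ℂ) :
    schwartzTransport (reindexCLE E) (rhoS (p ∘ E.symm) (q ∘ E.symm) f) =
      rhoS p q (schwartzTransport (reindexCLE E) f) := by
  rw [← rhoSD_reindexCLE, schwartzTransport_rhoSD]

/-! ## §2 The `L²` side: the permutation unitary and transport of lifts -/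

/-- `(g ∘ E_*) ∘ E_*⁻¹ = g` in `L²`. [folklore] -/
theorem l2Transport_compMeasurePreserving_reindexCLE (E : σ ≃ σ') (g : Lp ℂ 2 (volume : Measure (σ → ℝ))) :
    l2Transport (reindexCLE E) (measurePreserving_reindexCLE_symm E)
        (Lp.compMeasurePreserving (reindexCLE E) (measurePreserving_reindexCLE E) g) = g := by
  apply Lp.ext
  have h1 := coeFn_l2Transport (reindexCLE E) (measurePreserving_reindexCLE_symm E)
    (Lp.compMeasurePreserving (reindexCLE E) (measurePreserving_reindexCLE E) g)
  have h2 : (fun x : σ → ℝ =>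
      (Lp.compMeasurePreserving (reindexCLE E) (measurePreserving_reindexCLE E) g : (σ' → ℝ) → ℂ)
        ((reindexCLE E).symm x)) =ᵐ[volume]
      fun x => (g ∘ reindexCLE E) ((reindexCLE E).symm x) :=
    (measurePreserving_reindexCLE_symm E).quasiMeasurePreserving.ae_eq_comp
      (Lp.coeFn_compMeasurePreserving g (measurePreserving_reindexCLE E))
  filter_upwards [h1, h2] with x hx1 hx2
  rw [hx1, hx2, Function.comp_apply, ContinuousLinearEquiv.apply_symm_apply]

/-- **The permutation unitary** `L²(ℝ^{σ′}) ≃ₗᵢ L²(ℝ^σ)` of the relabelling `E`. [folklore] -/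
def l2Reindex (E : σ ≃ σ') : Lp ℂ 2 (volume : Measure (σ' → ℝ)) ≃ₗᵢ[ℂ] Lp ℂ 2 (volume : Measure (σ → ℝ)) :=
  LinearIsometryEquiv.ofSurjective (l2Transport (reindexCLE E) (measurePreserving_reindexCLE_symm E))
    fun g => ⟨_, l2Transport_compMeasurePreserving_reindexCLE E g⟩

/-- unfolding. [folklore] -/
theorem l2Reindex_apply (E : σ ≃ σ') (g : Lp ℂ 2 (volume : Measure (σ' → ℝ))) :
    l2Reindex E g = l2Transport (reindexCLE E) (measurePreserving_reindexCLE_symm E) g := rfl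

/-- `toL2 ∘ schwartzTransport (reindexCLE E) = l2Reindex E ∘ toL2`. [folklore] -/
theorem toL2_schwartzTransport_reindexCLE (E : σ ≃ σ') (f : SchwartzMap (σ' → ℝ) ℂ) :
    toL2 (schwartzTransport (reindexCLE E) f) = l2Reindex E (toL2 f) :=
  toL2_schwartzTransport (reindexCLE E) (measurePreserving_reindexCLE_symm E) f

/-- **Transport of lifts along the relabelling**: if `A` on `𝓢(ℝ^{σ′})` is the restriction of `U` on `L²`, then
`e_* ∘ A ∘ e_*⁻¹` is the restriction of any `V` with `l2Reindex ∘ U = V ∘ l2Reindex`. [folklore] -/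
theorem liftsTo_opTransport_reindex (E : σ ≃ σ') {A : SchwartzMap (σ' → ℝ) ℂ →ₗ[ℂ] SchwartzMap (σ' → ℝ) ℂ}
    {U : Lp ℂ 2 (volume : Measure (σ' → ℝ)) →L[ℂ] Lp ℂ 2 (volume : Measure (σ' → ℝ))} (hA : LiftsTo A U)
    (V : Lp ℂ 2 (volume : Measure (σ → ℝ)) →L[ℂ] Lp ℂ 2 (volume : Measure (σ → ℝ)))
    (hV : ∀ g, l2Reindex E (U g) = V (l2Reindex E g)) :
    LiftsTo (opTransport (reindexCLE E) A) V := by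
  intro f
  rw [opTransport_apply, toL2_schwartzTransport_reindexCLE, hA, hV, ← toL2_schwartzTransport_reindexCLE,
    ContinuousLinearEquiv.apply_symm_apply]

end Carrier

/-! ## §3 Transport of an archimedean Weil datum along the relabelling -/

section Datum

variable {σ σ' : Type*} [Fintype σ] [Fintype σ'] {Ginf : Type*} [Group Ginf] [TopologicalSpace Ginf]

omit [Fintype σ] [Fintype σ'] in
/-- `(F ∘ E) ∘ E⁻¹ = F`. [folklore] -/
theorem comp_equiv_comp_symm (E : σ ≃ σ') (F : σ' → ℝ) : (F ∘ E) ∘ E.symm = F := by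
  funext j
  simp only [Function.comp_apply, Equiv.apply_symm_apply]

/-- **An archimedean Weil datum relabelled is an archimedean Weil datum**: conjugating `ω` by the permutation
`𝓢(ℝ^{σ′}) ≃ 𝓢(ℝ^σ)` gives a datum over `reindexSp E ∘ ι𝕎`. [cite: Weil1964, Chap. I n° 12, p. 160; Folland1989, §1.3 (1.25),
§4.2 (4.23)] -/
theorem IsArchWeilDatum.reindex (E : σ ≃ σ') {ι𝕎 : Ginf →* symplecticGroup (polar (dotPairing σ'))}
    {ω : Representation ℂ Ginf (SchwartzMap (σ' → ℝ) ℂ)} (hW : IsArchWeilDatum ι𝕎 ω) :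
    IsArchWeilDatum ((reindexSp E).comp ι𝕎) (repTransport (reindexCLE E) ω) := by
  refine IsArchWeilDatum.of_carrier (reindexCLE E) ?_ ?_ ?_
  · exact hW.continuous_apply
  · intro g p q f
    have hcov := hW.covariant g (p ∘ E.symm) (q ∘ E.symm) f
    show ω g (rhoSD (reindexCLE E) p q f) =
      rhoSD (reindexCLE E) (((reindexSp E (ι𝕎 g)).1 : ((σ → ℝ) × (σ → ℝ)) ≃ₗ[ℝ] ((σ → ℝ) × (σ → ℝ))) (p, q)).1
        (((reindexSp E (ι𝕎 g)).1 : ((σ → ℝ) × (σ → ℝ)) ≃ₗ[ℝ] ((σ → ℝ) × (σ → ℝ))) (p, q)).2 (ω g f)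
    rw [rhoSD_reindexCLE, rhoSD_reindexCLE, hcov, coe_reindexSp_apply]
    simp only [reindexPV_apply, reindexPV_symm_apply, comp_equiv_comp_symm]
  · intro g
    obtain ⟨U, hU⟩ := hW.exists_lift g
    refine ⟨((l2Reindex E).symm.trans U).trans (l2Reindex E), ?_⟩
    exact liftsTo_opTransport_reindex E hU _ fun x => by simp

/-- … and along a continuous homomorphism of groups at the same time. [folklore] -/
theorem IsArchWeilDatum.reindex_comp (E : σ ≃ σ') {ι𝕎 : Ginf →* symplecticGroup (polar (dotPairing σ'))}
    {ω : Representation ℂ Ginf (SchwartzMap (σ' → ℝ) ℂ)} (hW : IsArchWeilDatum ι𝕎 ω)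
    {H : Type*} [Group H] [TopologicalSpace H] (φ : H →* Ginf) (hφ : Continuous φ) :
    IsArchWeilDatum (((reindexSp E).comp ι𝕎).comp φ) ((repTransport (reindexCLE E) ω).comp φ) :=
  (hW.reindex E).comp φ hφ

omit [TopologicalSpace Ginf] in
/-- the transported operators are continuous when the original ones are. [folklore] -/
theorem continuous_repTransport_reindexCLE (E : σ ≃ σ') {ω : Representation ℂ Ginf (SchwartzMap (σ' → ℝ) ℂ)}
    (hc : ∀ g, Continuous (ω g)) (g : Ginf) : Continuous (repTransport (reindexCLE E) ω g) := by
  rw [show (repTransport (reindexCLE E) ω g : SchwartzMap (σ → ℝ) ℂ → SchwartzMap (σ → ℝ) ℂ) =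
      fun f => schwartzTransport (reindexCLE E) (ω g ((schwartzTransport (reindexCLE E)).symm f)) from
    funext fun f => repTransport_apply _ _ _ _]
  exact (schwartzTransport (reindexCLE E)).continuous.comp ((hc g).comp (schwartzTransport (reindexCLE E)).symm.continuous)

omit [TopologicalSpace Ginf] in
/-- on pure relabelled vectors: `(repTransport (reindexCLE E) ω g) (f ∘ E_*⁻¹) = (ω g f) ∘ E_*⁻¹`, i.e. the transported
representation is `ω` read through `schwartzTransport (reindexCLE E)`. [folklore] -/
theorem repTransport_reindexCLE_apply_schwartzTransport (E : σ ≃ σ')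
    (ω : Representation ℂ Ginf (SchwartzMap (σ' → ℝ) ℂ)) (g : Ginf) (f : SchwartzMap (σ' → ℝ) ℂ) :
    repTransport (reindexCLE E) ω g (schwartzTransport (reindexCLE E) f) =
      schwartzTransport (reindexCLE E) (ω g f) := by
  rw [repTransport_apply, ContinuousLinearEquiv.symm_apply_apply]

end Datum

end Literature.NumberTheory.Weil1964
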